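import Summits.NavierStokesRegularity.NavierStokesRegularity.Theorems.TypeICertificateLadderTargetStretchingNumber
import HarnessLib

/-!
# Crux `Target` = `TypeICertificateLadder.NoTypeIBlowup` (stmt-NavierStokesRegularity-1217), line
# `depletion-ladder` / ceiling-lift line `ExtremiserTransience`: THE LOG-MEAN STRETCHING LAW

`--supports stmt-NavierStokesRegularity-1217` (helper). Author: STA lineage `ns-sta-19551-p1` (g11).

Along a classical solution on `[0,T)` write `ω = curl u`, `J(t) = ∫⟪ω, Du ω⟫`, `Z = ‖ω‖₂²`, `W = ‖∇ω‖₂²` and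
the dimensionless STRETCHING NUMBER `S(t) = √((T−t)/ν) · J(t)/(√Z √W)` (`…TargetStretchingNumber`: the
sup form `limsup S < 1 ⇒ extension`). The enstrophy balance `½ Ż = J − νW ≤ S²Z/(4(T−t))` integrates the
weight `S(t)²/(T−t)` in time, so the sharp per-solution statement is about the LOG-TIME QUADRATIC MEAN of
`S` (weight `dτ/(T−τ)`), with NO rate hypothesis at all:

* `lintegral_curl_sq_le_rpow_of_logMean_stretching` — if from an onset `t₁ ∈ [0,T)` a measurable majorant
  `σ` of the stretching number works (`J(t) ≤ σ(t)·√(ν/(T−t))·√Z·√W` on `[t₁,T)`, `σ²/(T−τ)` locally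
  integrable) with `∫_{t₁}^t σ(τ)² dτ/(T−τ) ≤ ρ² log((T−t₁)/(T−t)) + B` for all `t ∈ [t₁,T)`, then
  `∫‖curl u(t)‖² ≤ K (T−t)^{−ρ²/2}` on `(0,T)`;
* `hasSmoothExtensionPast_of_logMean_stretching` — **THE LOG-MEAN STRETCHING LAW**: if moreover `ρ² < 1`
  the classical Leray–Hopf rapidly-decaying-datum solution extends smoothly past `T` (Leray's `H¹` rate has
  exponent `1/2`, `hasSmoothExtensionPast_of_powerRate`);
* `exists_logMean_stretching_gt_of_not_hasSmoothExtensionPast` — contrapositive PORTRAIT of a singular time: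
  every admissible majorant `σ` of `S` from every onset has log-time quadratic mean `≥ 1`
  (`∀ ρ² < 1, ∀ B, ∃ t, ∫_{t₁}^t σ²/(T−τ) > ρ² log((T−t₁)/(T−t)) + B`) — Type I or Type II alike;
* the PRODUCT form (depletion coefficient × amplitude majorant, plain time integral
  `∫ (k m)² ≤ ν(ρ² log + B)`), which contains the constant / eventual depletion rungs, the log-amplitude rung
  (p543431) and `AveragedRung` (stmt-21885, p574441) as instances and is the `s`-variant of crux K1
  `NearExtremalTransience` (`Cruxes/NearExtremalTransience/Lines/birth.md`, point 5), is the sequel file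
  `…TargetStretchingLogMeanProduct`.

Proofs: the per-slice-multiplier slab Grönwall `lintegral_curl_sq_le_exp_stretching` with `L = ‖u(s)‖_∞`
(Cauchy–Schwarz, `stretching_le_sup_mul`) before the late onset `t₀ = (t₁+T)/2` and `L = σ√(ν/(T−s))` after;
`∫₀ᵗ L² ≤ B₀²T + ν(max B 0 + ρ² log(T/(T−t)))`.

WHAT THIS IS NOT: no depletion and no rate is proved; a per-solution criterion and its contrapositive. Nothing
here asserts that a singular time exists or does not exist. [folklore]

References: Leray 1934 §§19–20 (the `H¹` rate); Lemarié-Rieusset (2016), Thm. 11.2; Robinson–Rodrigo–Sadowski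
(2016), Lemma 8.16.
-/

noncomputable section

open Set Filter Topology MeasureTheory
open scoped RealInnerProductSpace ENNReal NNReal ContDiff
open Literature.Analysis.FluidPDE

namespace Summit.NavierStokesRegularity.NavierStokesRegularity.Theorems.DepletionLadder

-- the problem directory repeats the summit name (`NavierStokesRegularity/NavierStokesRegularity`)
set_option linter.dupNamespace false

open Summit.NavierStokesRegularity.NavierStokesRegularity.Theorems.RungReynoldsOne
open Summit.NavierStokesRegularity.NavierStokesRegularity.Theorems.RungReynoldsOne.WeightedSlice

/-! ## Bookkeeping of the log-mean hypothesis -/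

/-- The lower-Lebesgue form of a log-mean hypothesis: for `t₁ ≤ t < T`, `c ≥ 0` and a measurable `σ` with
`σ²/(T−τ)` interval integrable on `[t₁,t]`,
`∫⁻_{(t₁,t]} ofReal(c·σ²/(T−s)) ≤ ofReal(c·(ρ² log((T−t₁)/(T−t)) + B))` whenever
`∫_{t₁}^t σ²/(T−τ) ≤ ρ² log((T−t₁)/(T−t)) + B`. [folklore] -/
theorem lintegral_Ioc_sq_div_le_of_logMean {σ : ℝ → ℝ} {T t₁ t c ρ B : ℝ}
    (ht₁t : t₁ ≤ t) (htT : t < T) (hc : 0 ≤ c)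
    (hii : IntervalIntegrable (fun τ => σ τ ^ 2 / (T - τ)) volume t₁ t)
    (hmean : ∫ τ in t₁..t, σ τ ^ 2 / (T - τ) ≤ ρ ^ 2 * Real.log ((T - t₁) / (T - t)) + B) :
    ∫⁻ s in Ioc t₁ t, ENNReal.ofReal (c * (σ s ^ 2 / (T - s))) ≤
      ENNReal.ofReal (c * (ρ ^ 2 * Real.log ((T - t₁) / (T - t)) + B)) := by
  have hint : IntegrableOn (fun s => c * (σ s ^ 2 / (T - s))) (Ioc t₁ t) volume :=
    ((intervalIntegrable_iff_integrableOn_Ioc_of_le ht₁t).1 hii).const_mul c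
  have hnn : 0 ≤ᵐ[volume.restrict (Ioc t₁ t)] fun s => c * (σ s ^ 2 / (T - s)) := by
    refine (ae_restrict_mem measurableSet_Ioc).mono fun s hs => ?_
    have hTs : 0 < T - s := by linarith [hs.2]
    exact mul_nonneg hc (div_nonneg (sq_nonneg _) hTs.le)
  rw [← ofReal_integral_eq_lintegral_ofReal hint hnn]
  refine ENNReal.ofReal_le_ofReal ?_
  rw [integral_const_mul, ← intervalIntegral.integral_of_le ht₁t]
  exact mul_le_mul_of_nonneg_left hmean hc

/-! ## The slab step -/

/-- **A-priori power rate of the enstrophy under a LOG-MEAN stretching-number bound.** Let `u` be a classical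
solution of the unforced Navier–Stokes system on `ℝ³ × [0,T)` (`ν, T > 0`), Leray–Hopf from its rapidly decaying
datum. Suppose that from an onset `t₁ ∈ [0,T)` a measurable `σ` majorises the stretching number —
`∫⟪ω, Du ω⟫(t) ≤ σ(t) √(ν/(T−t)) ‖ω(t)‖₂ ‖∇ω(t)‖₂` for `t ∈ [t₁,T)` — with `σ²/(T−τ)` interval integrable on
every `[t₁,t]`, `t < T`, and log-time quadratic mean at most `ρ`:
`∫_{t₁}^t σ(τ)² dτ/(T−τ) ≤ ρ² log((T−t₁)/(T−t)) + B` for all `t ∈ [t₁,T)`. Then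
`∫‖curl u(t)‖² ≤ K (T−t)^{−ρ²/2}` for some `K ≥ 0` and all `t ∈ (0,T)`. [folklore] -/
theorem lintegral_curl_sq_le_rpow_of_logMean_stretching {ν ρ T t₁ B : ℝ} (hν : 0 < ν) (hT : 0 < T)
    (ht₁ : t₁ ∈ Ico 0 T)
    {u : ℝ → EuclideanSpace ℝ (Fin 3) → EuclideanSpace ℝ (Fin 3)}
    {p : ℝ → EuclideanSpace ℝ (Fin 3) → ℝ}
    (hsol : IsClassicalNSSolutionOn (Ico 0 T) ν 0 u p) (hLH : IsLerayHopfOn T ν 0 (u 0) u)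
    (hdec : HasRapidSpatialDecay (u 0))
    {σ : ℝ → ℝ}
    (hii : ∀ t ∈ Ico t₁ T, IntervalIntegrable (fun τ => σ τ ^ 2 / (T - τ)) volume t₁ t)
    (hS : ∀ t ∈ Ico t₁ T, ∫ x, ⟪curl (u t) x, fderiv ℝ (u t) x (curl (u t) x)⟫ ≤
      σ t * Real.sqrt (ν / (T - t)) * Real.sqrt (∫ x, ‖curl (u t) x‖ ^ 2) *
        Real.sqrt (∫ x, frobeniusNormSq (fderiv ℝ (curl (u t)) x)))
    (hmean : ∀ t ∈ Ico t₁ T, ∫ τ in t₁..t, σ τ ^ 2 / (T - τ) ≤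
      ρ ^ 2 * Real.log ((T - t₁) / (T - t)) + B) :
    ∃ K : ℝ, 0 ≤ K ∧ ∀ t ∈ Ioo 0 T,
      ∫⁻ x, ‖curl (u t) x‖ₑ ^ 2 ≤ ENNReal.ofReal (K * (T - t) ^ (-(ρ ^ 2 / 2))) := by
  -- the late onset `t₀ = (t₁ + T)/2 ∈ (t₁, T)`, `t₀ > 0`
  set t₀ : ℝ := (t₁ + T) / 2 with ht₀def
  have ht₁t₀ : t₁ < t₀ := by rw [ht₀def]; linarith [ht₁.2]
  have ht₀ : t₀ ∈ Ioo 0 T := by rw [ht₀def]; constructor <;> linarith [ht₁.1, ht₁.2]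
  -- a sup bound on `[0, t₀]` from the Tao cover at `T' = t₀`
  obtain ⟨q₀, hsol₀, hu₀, -, -⟩ := stub_taoCover hν hT hsol hLH hdec ht₀
  obtain ⟨B₀, hB₀0, hB₀⟩ := exists_forall_norm_le_of_hasBoundedSobolevNormsOn hsol₀ hu₀
  obtain ⟨C₁, hC₁⟩ := hu₀ 1
  -- the per-slice multiplier `L`
  set L : ℝ → ℝ := fun s => if s < t₀ then (eLpNorm (u s) ⊤ volume).toReal
    else σ s * Real.sqrt (ν / (T - s)) with hL
  -- before the onset: `L² ≤ B₀²`
  have hLsq_early : ∀ s ∈ Ico 0 T, s < t₀ → L s ^ 2 ≤ B₀ ^ 2 := by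
    intro s hs hst
    have h1 : (eLpNorm (u s) ⊤ volume).toReal ≤ B₀ :=
      toReal_eLpNorm_top_le_of_bound hB₀0 (hB₀ s ⟨hs.1, hst.le⟩)
    have hL' : L s = (eLpNorm (u s) ⊤ volume).toReal := by simp [hL, hst]
    rw [hL']
    nlinarith [ENNReal.toReal_nonneg (a := eLpNorm (u s) ⊤ volume)]
  -- after the onset: `L² = ν σ²/(T−s)`
  have hLsq_late : ∀ s ∈ Ico 0 T, ¬ s < t₀ → L s ^ 2 = ν * (σ s ^ 2 / (T - s)) := by
    intro s hs hst
    have hTs : 0 < T - s := sub_pos.2 hs.2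
    have hL' : L s = σ s * Real.sqrt (ν / (T - s)) := by simp [hL, hst]
    rw [hL', mul_pow, Real.sq_sqrt (div_nonneg hν.le hTs.le)]
    field_simp
  -- the integrated bound `∫₀ᵗ L² ≤ B₀²T + ν (max B 0 + ρ² log(T/(T−t)))`
  have hTt₁ : 0 < T - t₁ := sub_pos.2 ht₁.2
  have hΛ : ∀ t ∈ Ioo 0 T,
      ∫⁻ s in Ioo 0 t, ENNReal.ofReal (L s ^ 2) ≤
        ENNReal.ofReal (B₀ ^ 2 * T + ν * (max B 0 + ρ ^ 2 * Real.log (T / (T - t)))) := by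
    intro t ht
    have hTt : 0 < T - t := sub_pos.2 ht.2
    have hlog : 0 ≤ Real.log (T / (T - t)) :=
      Real.log_nonneg ((one_le_div hTt).2 (by linarith [ht.1]))
    have hρ2log : 0 ≤ ρ ^ 2 * Real.log (T / (T - t)) := mul_nonneg (sq_nonneg _) hlog
    have hrest0 : 0 ≤ ν * (max B 0 + ρ ^ 2 * Real.log (T / (T - t))) :=
      mul_nonneg hν.le (add_nonneg (le_max_right _ _) hρ2log)
    -- the early part `(0, min t t₀)`: constant bound
    have hearly : ∀ t' : ℝ, t' ≤ t₀ → t' ≤ T →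
        ∫⁻ s in Ioo 0 t', ENNReal.ofReal (L s ^ 2) ≤ ENNReal.ofReal (B₀ ^ 2 * T) := by
      intro t' ht't₀ ht'T
      by_cases ht'0 : t' ≤ 0
      · rw [Ioo_eq_empty (by intro h; linarith), Measure.restrict_empty, lintegral_zero_measure]
        exact bot_le
      have ht'0' : 0 < t' := lt_of_not_ge ht'0
      calc ∫⁻ s in Ioo 0 t', ENNReal.ofReal (L s ^ 2)
          ≤ ∫⁻ s in Ioo 0 t', ENNReal.ofReal (B₀ ^ 2) := by
            refine setLIntegral_mono' measurableSet_Ioo fun s hs => ENNReal.ofReal_le_ofReal ?_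
            by_cases hsT : s < T
            · by_cases hst₀ : s < t₀
              · exact hLsq_early s ⟨hs.1.le, hsT⟩ hst₀
              · exfalso; linarith [hs.2]
            · exfalso; linarith [hs.2]
        _ = ENNReal.ofReal (B₀ ^ 2) * volume (Ioo 0 t') := setLIntegral_const _ _
        _ = ENNReal.ofReal (B₀ ^ 2 * t') := by
            rw [Real.volume_Ioo, sub_zero, ← ENNReal.ofReal_mul (sq_nonneg _)]
        _ ≤ ENNReal.ofReal (B₀ ^ 2 * T) := ENNReal.ofReal_le_ofReal (by nlinarith [sq_nonneg B₀])
    by_cases htt₀ : t ≤ t₀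
    · -- early times only
      calc ∫⁻ s in Ioo 0 t, ENNReal.ofReal (L s ^ 2)
          ≤ ENNReal.ofReal (B₀ ^ 2 * T) := hearly t htt₀ ht.2.le
        _ ≤ ENNReal.ofReal (B₀ ^ 2 * T + ν * (max B 0 + ρ ^ 2 * Real.log (T / (T - t)))) :=
            ENNReal.ofReal_le_ofReal (le_add_of_nonneg_right hrest0)
    · -- late times: split at `t₀`
      have ht₀t : t₀ < t := lt_of_not_ge htt₀
      have ht₁t : t₁ < t := ht₁t₀.trans ht₀t
      have hsplit : Ioo 0 t ⊆ Ioo 0 t₀ ∪ Ico t₀ t := by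
        intro s hs
        by_cases h : s < t₀
        · exact Or.inl ⟨hs.1, h⟩
        · exact Or.inr ⟨not_lt.1 h, hs.2⟩
      have h1 : ∫⁻ s in Ioo 0 t₀, ENNReal.ofReal (L s ^ 2) ≤ ENNReal.ofReal (B₀ ^ 2 * T) :=
        hearly t₀ le_rfl ht₀.2.le
      -- on `[t₀, t)` the multiplier is `ν σ²/(T−s)`; enlarge the set to `(t₁, t]`
      have h2 : ∫⁻ s in Ico t₀ t, ENNReal.ofReal (L s ^ 2) ≤
          ENNReal.ofReal (ν * (ρ ^ 2 * Real.log ((T - t₁) / (T - t)) + B)) := by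
        calc ∫⁻ s in Ico t₀ t, ENNReal.ofReal (L s ^ 2)
            = ∫⁻ s in Ico t₀ t, ENNReal.ofReal (ν * (σ s ^ 2 / (T - s))) := by
              refine setLIntegral_congr_fun measurableSet_Ico fun s hs => ?_
              rw [hLsq_late s ⟨ht₀.1.le.trans hs.1, hs.2.trans ht.2⟩ (not_lt.2 hs.1)]
          _ ≤ ∫⁻ s in Ioc t₁ t, ENNReal.ofReal (ν * (σ s ^ 2 / (T - s))) := by
              refine (lintegral_mono_set (show Ico t₀ t ⊆ Icc t₁ t from
                fun s hs => ⟨ht₁t₀.le.trans hs.1, hs.2.le⟩)).trans_eq ?_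
              exact setLIntegral_congr Ioc_ae_eq_Icc.symm
          _ ≤ ENNReal.ofReal (ν * (ρ ^ 2 * Real.log ((T - t₁) / (T - t)) + B)) :=
              lintegral_Ioc_sq_div_le_of_logMean ht₁t.le ht.2 hν.le (hii t ⟨ht₁t.le, ht.2⟩)
                (hmean t ⟨ht₁t.le, ht.2⟩)
      have hB' : ρ ^ 2 * Real.log ((T - t₁) / (T - t)) + B ≤
          max B 0 + ρ ^ 2 * Real.log (T / (T - t)) := by
        have hmono : Real.log ((T - t₁) / (T - t)) ≤ Real.log (T / (T - t)) := by
          refine Real.log_le_log (div_pos hTt₁ hTt) ?_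
          exact div_le_div_of_nonneg_right (by linarith [ht₁.1]) hTt.le
        nlinarith [le_max_left B 0, sq_nonneg ρ]
      calc ∫⁻ s in Ioo 0 t, ENNReal.ofReal (L s ^ 2)
          ≤ ∫⁻ s in Ioo 0 t₀ ∪ Ico t₀ t, ENNReal.ofReal (L s ^ 2) := lintegral_mono_set hsplit
        _ ≤ (∫⁻ s in Ioo 0 t₀, ENNReal.ofReal (L s ^ 2)) +
              ∫⁻ s in Ico t₀ t, ENNReal.ofReal (L s ^ 2) := lintegral_union_le _ _ _
        _ ≤ ENNReal.ofReal (B₀ ^ 2 * T) +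
              ENNReal.ofReal (ν * (max B 0 + ρ ^ 2 * Real.log (T / (T - t)))) :=
            add_le_add h1 (h2.trans (ENNReal.ofReal_le_ofReal (mul_le_mul_of_nonneg_left hB' hν.le)))
        _ = ENNReal.ofReal (B₀ ^ 2 * T + ν * (max B 0 + ρ ^ 2 * Real.log (T / (T - t)))) :=
            (ENNReal.ofReal_add (by positivity) hrest0).symm
  -- finiteness of the enstrophy at time `0`
  have h00 : (0 : ℝ) ∈ Icc 0 t₀ := ⟨le_rfl, ht₀.1.le⟩
  have hZ0 : ∫⁻ x, ‖curl (u 0) x‖ₑ ^ 2 ≤ 6 * C₁ := by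
    calc ∫⁻ x, ‖curl (u 0) x‖ₑ ^ 2 ≤ ∫⁻ x, 6 * ‖iteratedFDeriv ℝ 1 (u 0) x‖ₑ ^ 2 :=
          lintegral_mono fun x => enorm_curl_sq_le_six_mul (u 0) x
      _ = 6 * ∫⁻ x, ‖iteratedFDeriv ℝ 1 (u 0) x‖ₑ ^ 2 := lintegral_const_mul' _ _ (by norm_num)
      _ ≤ 6 * C₁ := by gcongr; exact hC₁ 0 h00
  have hZ0top : ∫⁻ x, ‖curl (u 0) x‖ₑ ^ 2 ≠ ⊤ :=
    (hZ0.trans_lt (ENNReal.mul_lt_top (by norm_num) ENNReal.coe_lt_top)).ne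
  set Z0 : ℝ := (∫⁻ x, ‖curl (u 0) x‖ₑ ^ 2).toReal with hZ0def
  have hZ0nn : 0 ≤ Z0 := ENNReal.toReal_nonneg
  -- the constants
  set kν : ℝ := (2 * ν)⁻¹ with hkν
  have hk0 : 0 ≤ kν := by positivity
  set δ : ℝ := ρ ^ 2 / 2 with hδ
  have hδk : kν * (ν * ρ ^ 2) = δ := by
    rw [hkν, hδ]
    field_simp
  set K : ℝ := Real.exp (kν * (B₀ ^ 2 * T + ν * max B 0)) * T ^ δ * Z0 with hK
  refine ⟨K, by positivity, fun t ht => ?_⟩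
  obtain ⟨q, hsolt, hut, hutt, -⟩ := stub_taoCover hν hT hsol hLH hdec ht
  have hTt : 0 < T - t := sub_pos.2 ht.2
  have hΛt := hΛ t ht
  have hΛtop : ∫⁻ s in Ioo 0 t, ENNReal.ofReal (L s ^ 2) ≠ ⊤ :=
    (hΛt.trans_lt ENNReal.ofReal_lt_top).ne
  -- the per-slice production bound on `(0, t)`
  obtain ⟨B₀', hB₀'0, hB₀'⟩ := exists_forall_norm_le_of_hasBoundedSobolevNormsOn hsolt hut
  obtain ⟨B₁, hB₁0, hB₁⟩ := exists_forall_norm_fderiv_le_of_hasBoundedSobolevNormsOn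
    (fun s hs => (hsolt.contDiff_velocity hs).of_le (by norm_cast)) hut
  obtain ⟨D₁, hD₁⟩ := hut 1
  obtain ⟨D₂, hD₂⟩ := hut 2
  have hJ : ∀ s ∈ Ioo 0 t, ∫ x, ⟪curl (u s) x, fderiv ℝ (u s) x (curl (u s) x)⟫ ≤
      L s * Real.sqrt (∫ x, ‖curl (u s) x‖ ^ 2) *
        Real.sqrt (∫ x, frobeniusNormSq (fderiv ℝ (curl (u s)) x)) := by
    intro s hs
    have hsI : s ∈ Icc 0 t := ⟨hs.1.le, hs.2.le⟩
    by_cases hst : s < t₀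
    · have hL' : L s = (eLpNorm (u s) ⊤ volume).toReal := by simp [hL, hst]
      rw [hL']
      have cu : Continuous (u s) := (hsolt.contDiff_velocity hsI).continuous
      have hLtop : eLpNorm (u s) ⊤ volume < ⊤ := by
        rw [eLpNorm_exponent_top]
        exact (eLpNormEssSup_le_of_ae_bound (Eventually.of_forall (hB₀' s hsI))).trans_lt
          ENNReal.ofReal_lt_top
      have hNpt : ∀ x, ‖u s x‖ ≤ (eLpNorm (u s) ⊤ volume).toReal := fun x =>
        norm_le_toReal_eLpNorm_top_of_continuous cu hLtop x
      exact stretching_le_sup_mul ((hsolt.contDiff_velocity hsI).of_le (by norm_cast))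
        (hsolt.divFree s hsI) hNpt (hB₁ s hsI) ((hD₁ s hsI).trans_lt ENNReal.coe_lt_top)
        ((hD₂ s hsI).trans_lt ENNReal.coe_lt_top)
    · have hL' : L s = σ s * Real.sqrt (ν / (T - s)) := by simp [hL, hst]
      rw [hL']
      exact hS s ⟨ht₁t₀.le.trans (not_lt.1 hst), hs.2.trans ht.2⟩
  have hmain := lintegral_curl_sq_le_exp_stretching hν ht.1 hsolt hut hutt hJ ⟨ht.1, le_rfl⟩ hΛtop
  refine hmain.trans ?_
  have hlog : 0 ≤ Real.log (T / (T - t)) :=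
    Real.log_nonneg ((one_le_div hTt).2 (by linarith [ht.1]))
  have hrhs0 : 0 ≤ B₀ ^ 2 * T + ν * (max B 0 + ρ ^ 2 * Real.log (T / (T - t))) :=
    add_nonneg (by positivity) (mul_nonneg hν.le (add_nonneg (le_max_right _ _)
      (mul_nonneg (sq_nonneg _) hlog)))
  have hexp : Real.exp ((2 * ν)⁻¹ *
      (∫⁻ s in Ioo 0 t, ENNReal.ofReal (L s ^ 2)).toReal) ≤
      Real.exp (kν * (B₀ ^ 2 * T + ν * max B 0)) * (T / (T - t)) ^ δ := by
    have h1 : (∫⁻ s in Ioo 0 t, ENNReal.ofReal (L s ^ 2)).toReal ≤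
        B₀ ^ 2 * T + ν * (max B 0 + ρ ^ 2 * Real.log (T / (T - t))) :=
      ENNReal.toReal_le_of_le_ofReal hrhs0 hΛt
    have h2 := Real.exp_le_exp.2 (mul_le_mul_of_nonneg_left h1 hk0)
    refine h2.trans_eq ?_
    rw [show B₀ ^ 2 * T + ν * (max B 0 + ρ ^ 2 * Real.log (T / (T - t))) =
        (B₀ ^ 2 * T + ν * max B 0) + (ν * ρ ^ 2) * Real.log (T / (T - t)) by ring,
      exp_mul_add_mul_log (div_pos hT hTt), hδk]
  have hpow : (T / (T - t)) ^ δ = T ^ δ * (T - t) ^ (-δ) := by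
    rw [Real.div_rpow hT.le hTt.le, Real.rpow_neg hTt.le, div_eq_mul_inv]
  calc ENNReal.ofReal (Real.exp ((2 * ν)⁻¹ *
        (∫⁻ s in Ioo 0 t, ENNReal.ofReal (L s ^ 2)).toReal)) * ∫⁻ x, ‖curl (u 0) x‖ₑ ^ 2
      ≤ ENNReal.ofReal (Real.exp (kν * (B₀ ^ 2 * T + ν * max B 0)) * (T / (T - t)) ^ δ) *
          ENNReal.ofReal Z0 := by
        rw [ENNReal.ofReal_toReal hZ0top]
        gcongr
    _ = ENNReal.ofReal (K * (T - t) ^ (-δ)) := by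
        rw [← ENNReal.ofReal_mul (by positivity), hpow, hK]
        ring_nf

/-- **The `H¹`-type power rate under a log-mean stretching-number bound**:
`‖u(t)‖₂² + ‖∇u(t)‖₂² ≤ K′(T−t)^{−ρ²/2}` on `[T/2, T)` (energy `≤ 2E(u₀)`, `∫|∇u|² ≤ ∫|curl u|²`,
`lintegral_curl_sq_le_rpow_of_logMean_stretching`). [folklore] -/
theorem energy_add_enstrophy_le_rpow_of_logMean_stretching {ν ρ T t₁ B : ℝ} (hν : 0 < ν) (hT : 0 < T)
    (ht₁ : t₁ ∈ Ico 0 T)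
    {u : ℝ → EuclideanSpace ℝ (Fin 3) → EuclideanSpace ℝ (Fin 3)}
    {p : ℝ → EuclideanSpace ℝ (Fin 3) → ℝ}
    (hsol : IsClassicalNSSolutionOn (Ico 0 T) ν 0 u p) (hLH : IsLerayHopfOn T ν 0 (u 0) u)
    (hdec : HasRapidSpatialDecay (u 0))
    {σ : ℝ → ℝ}
    (hii : ∀ t ∈ Ico t₁ T, IntervalIntegrable (fun τ => σ τ ^ 2 / (T - τ)) volume t₁ t)
    (hS : ∀ t ∈ Ico t₁ T, ∫ x, ⟪curl (u t) x, fderiv ℝ (u t) x (curl (u t) x)⟫ ≤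
      σ t * Real.sqrt (ν / (T - t)) * Real.sqrt (∫ x, ‖curl (u t) x‖ ^ 2) *
        Real.sqrt (∫ x, frobeniusNormSq (fderiv ℝ (curl (u t)) x)))
    (hmean : ∀ t ∈ Ico t₁ T, ∫ τ in t₁..t, σ τ ^ 2 / (T - τ) ≤
      ρ ^ 2 * Real.log ((T - t₁) / (T - t)) + B) :
    ∃ K : ℝ, ∃ t₀ ∈ Ico 0 T, ∀ t ∈ Ico t₀ T,
      (∫⁻ x, ‖u t x‖ₑ ^ 2) + ∫⁻ x, ENNReal.ofReal (frobeniusNormSq (fderiv ℝ (u t) x)) ≤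
        ENNReal.ofReal (K * (T - t) ^ (-(ρ ^ 2 / 2))) := by
  obtain ⟨K, hK0, hK⟩ :=
    lintegral_curl_sq_le_rpow_of_logMean_stretching hν hT ht₁ hsol hLH hdec hii hS hmean
  set δ : ℝ := ρ ^ 2 / 2 with hδ
  have hδ0 : 0 ≤ δ := by positivity
  set E₀ : ℝ := 2 * VectorCalculus.kineticEnergy (u 0) with hE₀
  have hE : ∀ t ∈ Icc 0 T, ∫⁻ x, ‖u t x‖ₑ ^ 2 ≤ ENNReal.ofReal (max E₀ 0) := fun t ht =>
    (hLH.lintegral_enorm_sq_le hν.le ht).trans (ENNReal.ofReal_le_ofReal (le_max_left _ _))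
  refine ⟨max E₀ 0 * T ^ δ + K, T / 2, ⟨by positivity, by linarith⟩, fun t ht => ?_⟩
  have ht' : t ∈ Ioo 0 T := ⟨lt_of_lt_of_le (by positivity) ht.1, ht.2⟩
  have htc : t ∈ Icc 0 T := ⟨ht'.1.le, ht'.2.le⟩
  have htI : t ∈ Ico 0 T := ⟨ht'.1.le, ht'.2⟩
  have hTt : 0 < T - t := sub_pos.2 ht.2
  have hL2 : ∫⁻ x, ‖u t x‖ₑ ^ 2 < ⊤ := (hE t htc).trans_lt ENNReal.ofReal_lt_top
  have hG : ∫⁻ x, ENNReal.ofReal (frobeniusNormSq (fderiv ℝ (u t) x)) ≤ ∫⁻ x, ‖curl (u t) x‖ₑ ^ 2 :=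
    lintegral_frobeniusNormSq_fderiv_le_lintegral_sq_norm_curl
      ((hsol.contDiff_velocity htI).of_le (by norm_cast)) (hsol.divFree t htI) hL2
  have hone : 1 ≤ T ^ δ * (T - t) ^ (-δ) := by
    rw [Real.rpow_neg hTt.le, ← div_eq_mul_inv, ← Real.div_rpow hT.le hTt.le]
    exact Real.one_le_rpow ((one_le_div hTt).2 (by linarith [ht'.1])) hδ0
  have hE' : max E₀ 0 ≤ max E₀ 0 * T ^ δ * (T - t) ^ (-δ) := by
    have := mul_le_mul_of_nonneg_left hone (le_max_right E₀ 0)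
    rw [mul_one] at this
    simpa [mul_assoc] using this
  calc (∫⁻ x, ‖u t x‖ₑ ^ 2) + ∫⁻ x, ENNReal.ofReal (frobeniusNormSq (fderiv ℝ (u t) x))
      ≤ ENNReal.ofReal (max E₀ 0) + ENNReal.ofReal (K * (T - t) ^ (-δ)) :=
        add_le_add (hE t htc) (hG.trans (hK t ht'))
    _ = ENNReal.ofReal (max E₀ 0 + K * (T - t) ^ (-δ)) :=
        (ENNReal.ofReal_add (le_max_right _ _) (by positivity)).symm
    _ ≤ ENNReal.ofReal ((max E₀ 0 * T ^ δ + K) * (T - t) ^ (-δ)) := by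
        refine ENNReal.ofReal_le_ofReal ?_
        rw [add_mul]
        exact add_le_add hE' le_rfl

/-! ## The law and its portrait form -/

/-- **THE LOG-MEAN STRETCHING LAW.** A classical solution of the unforced Navier–Stokes system on
`ℝ³ × [0,T)` (`ν, T > 0`), Leray–Hopf from its rapidly decaying datum, whose stretching number admits from some
onset `t₁ ∈ [0,T)` a measurable majorant `σ` (`∫⟪ω, Du ω⟫(t) ≤ σ(t)·√(ν/(T−t))·‖ω(t)‖₂·‖∇ω(t)‖₂`,
`σ²/(T−τ)` interval integrable on each `[t₁,t]`) with log-time quadratic mean STRICTLY BELOW ONE —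
`∫_{t₁}^t σ(τ)² dτ/(T−τ) ≤ ρ² log((T−t₁)/(T−t)) + B` for all `t ∈ [t₁,T)`, `ρ² < 1` — extends smoothly past
`T`. No rate hypothesis: the sup form `hasSmoothExtensionPast_of_stretching_le` (`σ ≡ γ < 1` eventually), every
constant / eventual / mean-form depletion rung against a Type-I rate, and the log-amplitude rung are instances.
[folklore] -/
theorem hasSmoothExtensionPast_of_logMean_stretching {ν ρ T t₁ B : ℝ} (hν : 0 < ν) (hT : 0 < T)
    (hρ : ρ ^ 2 < 1) (ht₁ : t₁ ∈ Ico 0 T)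
    {u : ℝ → EuclideanSpace ℝ (Fin 3) → EuclideanSpace ℝ (Fin 3)}
    {p : ℝ → EuclideanSpace ℝ (Fin 3) → ℝ}
    (hsol : IsClassicalNSSolutionOn (Ico 0 T) ν 0 u p) (hLH : IsLerayHopfOn T ν 0 (u 0) u)
    (hdec : HasRapidSpatialDecay (u 0))
    {σ : ℝ → ℝ}
    (hii : ∀ t ∈ Ico t₁ T, IntervalIntegrable (fun τ => σ τ ^ 2 / (T - τ)) volume t₁ t)
    (hS : ∀ t ∈ Ico t₁ T, ∫ x, ⟪curl (u t) x, fderiv ℝ (u t) x (curl (u t) x)⟫ ≤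
      σ t * Real.sqrt (ν / (T - t)) * Real.sqrt (∫ x, ‖curl (u t) x‖ ^ 2) *
        Real.sqrt (∫ x, frobeniusNormSq (fderiv ℝ (curl (u t)) x)))
    (hmean : ∀ t ∈ Ico t₁ T, ∫ τ in t₁..t, σ τ ^ 2 / (T - τ) ≤
      ρ ^ 2 * Real.log ((T - t₁) / (T - t)) + B) :
    HasSmoothExtensionPast ν 0 u T := by
  have hδ : ρ ^ 2 / 2 < 1 / 2 := by linarith
  obtain ⟨K, t₀, ht₀, hK⟩ :=
    energy_add_enstrophy_le_rpow_of_logMean_stretching hν hT ht₁ hsol hLH hdec hii hS hmean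
  exact hasSmoothExtensionPast_of_powerRate hν hT hδ hsol hLH hdec ⟨t₀, ht₀, hK⟩

/-- **Portrait of a singular time: the stretching number has log-time quadratic mean `≥ 1`.** If the
classical Leray–Hopf rapidly-decaying-datum solution does NOT extend past `T`, then for every onset
`t₁ ∈ [0,T)`, every measurable majorant `σ` of the stretching number on `[t₁,T)` with `σ²/(T−τ)` locally
interval integrable, every `ρ² < 1` and every `B`, the log-mean budget is EXCEEDED at some `t ∈ [t₁,T)`:
`ρ² log((T−t₁)/(T−t)) + B < ∫_{t₁}^t σ²/(T−τ)`. (With a Type-I rate `√(T−t)‖u‖_∞ ≤ C√ν` and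
`σ = k·C` for a flow-wise depletion coefficient `k`, this is the contrapositive of `AveragedRung`; with no rate
it also binds Type-II singular times.) [folklore] -/
theorem exists_logMean_stretching_gt_of_not_hasSmoothExtensionPast {ν ρ T t₁ B : ℝ} (hν : 0 < ν)
    (hT : 0 < T) (hρ : ρ ^ 2 < 1) (ht₁ : t₁ ∈ Ico 0 T)
    {u : ℝ → EuclideanSpace ℝ (Fin 3) → EuclideanSpace ℝ (Fin 3)}
    {p : ℝ → EuclideanSpace ℝ (Fin 3) → ℝ}
    (hsol : IsClassicalNSSolutionOn (Ico 0 T) ν 0 u p) (hLH : IsLerayHopfOn T ν 0 (u 0) u)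
    (hdec : HasRapidSpatialDecay (u 0)) (hsing : ¬ HasSmoothExtensionPast ν 0 u T)
    {σ : ℝ → ℝ}
    (hii : ∀ t ∈ Ico t₁ T, IntervalIntegrable (fun τ => σ τ ^ 2 / (T - τ)) volume t₁ t)
    (hS : ∀ t ∈ Ico t₁ T, ∫ x, ⟪curl (u t) x, fderiv ℝ (u t) x (curl (u t) x)⟫ ≤
      σ t * Real.sqrt (ν / (T - t)) * Real.sqrt (∫ x, ‖curl (u t) x‖ ^ 2) *
        Real.sqrt (∫ x, frobeniusNormSq (fderiv ℝ (curl (u t)) x))) :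
    ∃ t ∈ Ico t₁ T, ρ ^ 2 * Real.log ((T - t₁) / (T - t)) + B < ∫ τ in t₁..t, σ τ ^ 2 / (T - τ) := by
  by_contra h
  push Not at h
  exact hsing (hasSmoothExtensionPast_of_logMean_stretching hν hT hρ ht₁ hsol hLH hdec hii hS h)

end Summit.NavierStokesRegularity.NavierStokesRegularity.Theorems.DepletionLadder

end
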